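import Mathlib.Combinatorics.Matroid.Circuit
import Mathlib.Combinatorics.Matroid.Rank.ENat
import Mathlib.Algebra.Order.BigOperators.Ring.Finset
import Mathlib.Data.Real.Basic
import Mathlib.Tactic.Positivity
import Mathlib.Tactic.Linarith
import Literature.Combinatorics.Matroid.HeppBound
import HarnessLib

/-!
# Volkov 2020 (NPB 961, 115232) §3.1 «Estimation of the numerator», Lemmas 3.1–3.3: the Hepp-sector monomial bounds for the 1-tree polynomial `D(z)` and for trees with cycle — PROVED, for the 1-tree (= basis) polynomial of ANY finite matroid

independent recomputation; certified where stated, statistical where stated; no new-physics claim.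

CITATION HEADER (venture `QEDPrecision`, cell `pub-qed`, track TROPICAL seat V3b = `pub-qed-trop-v3-lit-2` gen 8; VALUE-FREE: combinatorics of
1-trees / bases and monomial inequalities only — no Feynman integrand, nothing per word). Companion of `Volkov2020.UVDegreeHandshake` (ω(s) and
eq. (1.5)'s Speer exponent), `Volkov2020.SpeerFormHalf` (Theorem 3.1 ⇒ (1.9)) and `Volkov2020.DenominatorLemmaArithmetic` (Lemma 3.4); serves
`tropical/view/V3-VOLKOV-DEGREES.md` §B B.24/B.26 («not in the kernel: Theorem 3.1's proof pieces, Lemmas 3.1–3.3») and B.26.1 (c) (T2-COMPATIBILITY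
L22's three power-counting summands ↔ Lemma 3.3: «|F| powers of the measure» ↔ |s^{[l]}|, «U ~ ρ^{L(F)} in the U⁻² Jacobian» ↔ −2·Loop(s^{[l]}) =
Lemma 3.2 squared, «one power per internal contraction» ↔ −|P[s^{[l]}]|).

Source. [Volkov2020] S. Volkov, "Infrared and ultraviolet power counting on the mass shell in quantum electrodynamics", Nucl. Phys. B 961
(2020) 115232 = arXiv:1912.04885v4 (e-print tex `iclos_arxiv.tex`, held by the cell under `pub-qed-trop-v3-lit-2/sources/arxiv-1912.04885/`),
VERBATIM:
* §2.1 (journal p.7; tex l.150–157): "A set s ⊆ E(G): is called an *1-tree*, if there is a path in s between any v₁,v₂ ∈ V(G) and s does not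
  have cycles; is called a *tree with cycle* if it has a cycle and it becomes a 1-tree after deleting any line of this cycle. … by Loop(s) we
  denote the minimum of |s∖T|, where T runs over all 1-trees of G."
* §2.2.1 (journal p.8; tex l.213–218): "The global multiplier 1/D(z)² starts the product, where D(z) = Σ_T ∏_{l∈E(G)∖T} z_l, the summation goes over all
  1-trees in G." and (journal p.8–9; tex l.226–232) "B_{l₁l₂}(z) = Σ_{T′} c(T′) ∏_{l∈E(G)∖T′} z_l, the summation goes over all trees with cycle containing l₁
  and l₂ on the cycle, c(T′) = 1 if the direction of l₁ and l₂ on the cycle is the same, c(T′) = −1 if the direction is opposite."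
* §3.1 (journal p.10–11; tex l.296–302): "Let j₁,…,j_L be the permutation of 1,…,L satisfying (1.6) [z_{j₁} ≥ z_{j₂} ≥ … ≥ z_{j_L}]. By s^{[l]} we
  denote the set {j_l, j_{l+1}, …, j_L}. Also, we will use the notation t₁ = z_{j₁}, t₂ = z_{j₂}/z_{j₁}, …, t_L = z_{j_L}/z_{j_{L−1}}. We will also
  use the fact that z₁,…,z_L are Feynman parameters, i.e., z₁+…+z_L = 1. Therefore, t₁,…,t_L ≤ 1."
* **Lemma 3.1** (journal p.11; tex l.304–314): "For any T ⊆ E(G) we have ∏_{l∈E(G)∖T} z_l = ∏_{l=1}^{L} t_l^{|s^{[l]}∖T|}." Proof: "∏_{l∈E(G)∖T} z_l =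
  ∏_{j_l∈E(G)∖T} z_{j_l} = ∏_{j_l∈E(G)∖T} (t₁t₂…t_l) = ∏_{l=1}^{L} t_l^{|s^{[l]}∖T|}."
* **Lemma 3.2** (journal p.11; tex l.316–325): "The following inequality is satisfied [fn 22: Also, it can be proved that the inequality is
  satisfied in both directions: the sign ≥ can be changed to ≤ (however, this fact is not needed for our examination).]: D(z) ≥ C ∏_{l=1}^{L}
  t_l^{Loop(s^{[l]})}, where C > 0 is some constant (depending only on the structure of the graph)." Proof: "Taking into account Lemma 3.1, we
  should only prove that there exists a 1-tree T such that |s^{[l]}∖T| = Loop(s^{[l]}) for all l. This 1-tree can be obtained by adding lines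
  (starting from the empty set) to complement the set to a maximal acyclic set in s^{[l]} sequentially for l = L, L−1, …, 1."
* **Lemma 3.3** (journal p.11; tex l.327–358): "|K(z)| ≤ C·∏_{l=1}^{L} t_l^{|s^{[l]}|−2·Loop(s^{[l]})−|P[s^{[l]}]|}/(z₁…z_L)", whose proof reads, for the
  factors B_{j₁j₂}(z)/D(z): "Let us fix j₁, j₂ and T′ from (2.3). From Lemmas 3.1 and 3.2 it follows that this tuple gives a contribution not
  exceeding (in absolute value) C·∏_{l=1}^{L} t_l^{a_l} … where a_l = |s^{[l]}∖T′| − Loop(s^{[l]}). If j₁,j₂ ∈ s^{[l]}, then T′ becomes acyclic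
  in s^{[l]} after removing j₁; thus a_l ≥ −1. If j₁ or j₂ is not in s^{[l]}, then the cycle of T′ is not contained in s^{[l]}, i.e., T′ ∩ s^{[l]}
  is acyclic, a_l ≥ 0."

READING (the only modelling step). The 1-trees of a connected graph are the bases of its cycle matroid, "acyclic" = independent, "cycle" =
circuit, and Loop(s) = min_T |s∖T| is then |s| − rank(s), the corank ("loop number") ℓ(s) of Panzer 2022 §2.3 already in the tree
(`Literature.Combinatorics.Matroid.corank`). Every statement below is therefore typed for an ARBITRARY matroid `M` on a finite type of
"lines" (Mathlib's `Matroid`; for a graph take its cycle matroid with ground set all lines — nothing graph-specific is used in the printed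
proofs either, which argue with "maximal acyclic sets" only), and `D` is the basis ("1-tree") polynomial `Σ_{T base} ∏_{l∉T} z_l` (for a
connected graph: the first Symanzik / Kirchhoff polynomial). `-- TODO(general form)`: the dictionary "1-trees of G = bases of the cycle matroid
of G" for the tree's edge-list graphs (`GraphPeriod.lean` encodes Ψ_G as a determinant; the matrix-tree theorem is not in the tree).

HEPP COORDINATES. The lines are numbered ALONG THE SECTOR: our line `k : Fin L` is Volkov's `j_{k+1}`, so the sector (1.6) is
`z 0 ≥ z 1 ≥ ⋯ ≥ z (L−1)`, `s^{[l]}` is `suffix L l = {k | l ≤ k}` (`suffix L 0 = univ`, `suffix L L = ∅`; Volkov's s^{[l]} is our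
`suffix L (l−1)`), and the sector variables enter through their inverse map `heppZ t k = t 0 · t 1 ⋯ t k` (Volkov's z_{j_l} = t₁t₂…t_l, the
display in the proof of Lemma 3.1); `heppZ_ratio` recovers "t_l = z_{j_l}/z_{j_{l−1}}". A general sector is this one after renaming the lines
(the matroid is arbitrary, so nothing is lost). The hypothesis "t_l ≤ 1" is used exactly where the printed proofs use it (the upper bounds),
and only for l ≥ 2 (our `0 < k`): the exponent of t₁ is the same for every 1-tree (`card_univ_sdiff_eq_loopNum`).

WHAT THE KERNEL CERTIFIES (all PROVED, Mathlib + `Combinatorics/Matroid/HeppBound` only; no named fact):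
* `oneTrees M` (the finset of bases, as finsets), `loopNum M s` = **Loop(s) AS PRINTED** (a `min'` over `oneTrees`), `loopNum_le`,
  `exists_card_sdiff_eq_loopNum`; **`loopNum_eq_corank`: Loop(s) = |s| − rank(s)** = Panzer's ℓ(s) (so `UVDegreeHandshake`'s abstract `loops`
  field and the track's «Loop» columns are this number); `card_univ_sdiff_eq_loopNum` (|E∖T| = Loop(E) for EVERY 1-tree T).
* **The nested 1-tree of Lemma 3.2's proof**, matroid form: `exists_isBase_nested` — for any increasing chain X₀ ⊆ X₁ ⊆ ⋯ of line sets there is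
  ONE base B with B ∩ X_m a basis of X_m for all m ≤ n (induction = "adding lines … sequentially"); hence `exists_isBase_suffix_nested`: a
  1-tree T with |s^{[l]}∖T| = Loop(s^{[l]}) for all l simultaneously.
* **Lemma 3.1** `prod_heppZ_eq`: ∏_{k∈A} z_k = ∏_k t_k^{|A ∩ s^{[k]}|}` for every line set A (any commutative monoid of values), and
  `treeSum_heppZ` (D in the sector variables, term by term).
* **Lemma 3.2, both directions with explicit constants** (values in `ℝ`): `prod_pow_loopNum_le_treeSum` — ∏_k t_k^{Loop(s^{[k]})} ≤ D(z(t)) for all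
  t ≥ 0 (C = 1; no sector hypothesis needed); `treeSum_le_card_mul_prod_pow_loopNum` — D(z(t)) ≤ (#1-trees)·∏_k t_k^{Loop(s^{[k]})} whenever
  0 ≤ t and t_k ≤ 1 for k ≥ 1 (footnote 22's "both directions"); `lemma32` — the printed ∃ C > 0 form.
* **Lemma 3.3's exponents** for a tree with cycle T′ (typed AS PRINTED: `IsTreeWithCycle M T′` = ∃ circuit C ⊆ T′ with T′∖{e} a 1-tree for every
  e ∈ C; `isTreeWithCycle_insert`: a 1-tree plus one further line is one): `corank_le_card_sdiff_add_one` (a_l ≥ −1 always) and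
  `corank_le_card_sdiff_of_not_subset` (a_l ≥ 0 when the cycle ⊄ s) for EVERY line set s; in the sector, `prod_heppZ_treeWithCycle_le`:
  ∏_{k∉T′} z_k ≤ ∏_k t_k^{Loop(s^{[k]}) − [j₁, j₂ ∈ s^{[k]}]} for j₁, j₂ on the cycle (0 ≤ t, t_k ≤ 1 for k ≥ 1) — the per-tuple bound of the
  printed proof, `prod_heppZ_treeWithCycle_mul_le` (the same in product form), and `one_le_corank_of_circuit_subset` (a set containing the
  cycle has Loop ≥ 1, so the "−1" is an honest natural-number subtraction).
* **Lemma 3.3 assembled**: with `cycleTrees M l₁ l₂` (the trees with cycle "containing l₁ and l₂ on the cycle"), `cycleSum` = B_{l₁l₂}(z) for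
  ARBITRARY coefficients c(T′) with |c(T′)| ≤ 1 (the printed signs ±1 are an orientation datum of the graph, irrelevant to the bound),
  `kFactor` = K(z) = D⁻²·∏_{p∈P} B_p/D and `pairsIn P s` = |P[s]|: `abs_cycleSum_div_treeSum_le` (each factor |B_p/D| ≤ N_p·∏ t^{−[p ⊆ s^{[k]}]}),
  **`lemma33`**: |K(z)| ≤ C·∏_k t_k^{−(2·Loop(s^{[k]}) + |P[s^{[k]}]|)} on the open sector with the explicit constant C = ∏_{p∈P} #cycleTrees(p),
  and **`lemma33_printed`**: the display "|K(z)| ≤ C·∏_l t_l^{|s^{[l]}|−2·Loop(s^{[l]})−|P[s^{[l]}]|}/(z₁…z_L)" (integer powers; the two agree by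
  Lemma 3.1 with T = ∅, the printed "the right part equals C·∏ t_l^{−2·Loop(s^{[l]})−|P[s^{[l]}]|}").
NOT claimed: the tensor structure Y_j(z) and the sum over j with P_j = P in (3.1) (outside K), the matrix-tree identification D = Ψ_G for
the tree's edge-list graphs, Lemmas 3.4–3.9 and Theorem 3.1 itself; T2's forest terms are not in print here.
-/

namespace Literature.MathematicalPhysics.QuantumFieldTheory.Volkov2020

open Finset
open Literature.Combinatorics.Matroid (corank corank_empty)

noncomputable section

/-! ## Rank bookkeeping and the nested basis (matroid on any type) -/

section SetLevel

variable {α : Type*} (M : Matroid α)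

/-- The rank of a finite line set is finite (≤ |s|). [folklore] -/
private theorem eRk_coe_ne_top (s : Finset α) : M.eRk (s : Set α) ≠ ⊤ := by
  have h : M.eRk (s : Set α) ≤ (s.card : ℕ∞) := by
    simpa [Set.encard_coe_eq_coe_finsetCard] using M.eRk_le_encard (s : Set α)
  exact ne_top_of_le_ne_top (ENat.coe_ne_top _) h

/-- Induction step of "adding lines … to complement the set to a maximal acyclic set in s^{[l]} sequentially": along an increasing chain
X₀ ⊆ X₁ ⊆ ⋯ there is a basis of X_n whose trace on every earlier X_m is a basis of X_m. [cite: Volkov2020, proof of Lemma 3.2 (journal p.11; tex l.323–325)] -/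
theorem exists_isBasis'_nested (X : ℕ → Set α) (hX : Monotone X) (n : ℕ) :
    ∃ I, M.IsBasis' I (X n) ∧ ∀ m ≤ n, M.IsBasis' (I ∩ X m) (X m) := by
  induction n with
  | zero =>
    obtain ⟨I, hI⟩ := M.exists_isBasis' (X 0)
    refine ⟨I, hI, fun m hm => ?_⟩
    obtain rfl : m = 0 := Nat.le_zero.1 hm
    rwa [Set.inter_eq_self_of_subset_left hI.subset]
  | succ n ih =>
    obtain ⟨I, hI, hnest⟩ := ih
    obtain ⟨J, hJ, hIJ⟩ := hI.indep.subset_isBasis'_of_subset (hI.subset.trans (hX (Nat.le_succ n)))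
    refine ⟨J, hJ, fun m hm => ?_⟩
    rcases Nat.lt_or_ge m (n + 1) with hlt | hge
    · have hm' : m ≤ n := Nat.lt_succ_iff.1 hlt
      have hK := hnest m hm'
      have heq : I ∩ X m = J ∩ X m :=
        hK.eq_of_subset_indep (hJ.indep.subset Set.inter_subset_left)
          (Set.inter_subset_inter_left _ hIJ) Set.inter_subset_right
      rwa [← heq]
    · obtain rfl : m = n + 1 := le_antisymm hm hge
      rwa [Set.inter_eq_self_of_subset_left hJ.subset]

/-- **The nested 1-tree** (matroid form of the sentence proving Lemma 3.2): along an increasing chain X₀ ⊆ X₁ ⊆ ⋯ ⊆ X_n of line sets there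
is ONE base B with B ∩ X_m a basis ("maximal acyclic set") of X_m for every m ≤ n. [cite: Volkov2020, proof of Lemma 3.2 (journal p.11; tex l.323–325)] -/
theorem exists_isBase_nested (X : ℕ → Set α) (hX : Monotone X) (n : ℕ) :
    ∃ B, M.IsBase B ∧ ∀ m ≤ n, M.IsBasis' (B ∩ X m) (X m) := by
  obtain ⟨I, hI, hnest⟩ := exists_isBasis'_nested M X hX n
  obtain ⟨B, hB, hIB⟩ := hI.indep.exists_isBase_superset
  refine ⟨B, hB, fun m hm => ?_⟩
  have hK := hnest m hm
  have heq : I ∩ X m = B ∩ X m :=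
    hK.eq_of_subset_indep (hB.indep.subset Set.inter_subset_left)
      (Set.inter_subset_inter_left _ hIB) Set.inter_subset_right
  rwa [← heq]

end SetLevel

/-! ## |s ∖ T| against |s| − rank(s); trees with cycle (finsets of lines) -/

section FinsetLevel

variable {α : Type*} [DecidableEq α] (M : Matroid α)

/-- For an independent (e.g. a 1-tree) T, |s ∩ T| ≤ rank(s): an independent subset of s has at most rank(s) elements. [folklore] -/
private theorem card_inter_le_eRk_toNat (s : Finset α) {T : Finset α} (hT : M.Indep (T : Set α)) :
    (s ∩ T).card ≤ (M.eRk (s : Set α)).toNat := by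
  have hsub : ((s ∩ T : Finset α) : Set α) ⊆ (T : Set α) := by
    push_cast; exact Set.inter_subset_right
  have hsubs : ((s ∩ T : Finset α) : Set α) ⊆ (s : Set α) := by
    push_cast; exact Set.inter_subset_left
  have h := (hT.subset hsub).encard_le_eRk_of_subset hsubs
  rw [Set.encard_coe_eq_coe_finsetCard, ← ENat.coe_toNat (eRk_coe_ne_top M s)] at h
  exact_mod_cast h

/-- Hence Panzer's corank is a lower bound: ℓ(s) = |s| − rank(s) ≤ |s∖T| for every independent T. [cite: Volkov2020, §2.1 with Lemma 3.2 (journal p.7, p.11)] -/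
theorem corank_le_card_sdiff (s : Finset α) {T : Finset α} (hT : M.Indep (T : Set α)) :
    corank M s ≤ (s \ T).card := by
  have h1 := card_inter_le_eRk_toNat M s hT
  have h2 := Finset.card_sdiff_add_card_inter s T
  unfold corank
  omega

/-- If T ∩ s is a basis of s (for a 1-tree T: T is "maximal acyclic in s"), then |s∖T| = |s| − rank(s). [cite: Volkov2020, proof of Lemma 3.2 (journal p.11; tex l.323–325)] -/
theorem card_sdiff_eq_corank_of_isBasis' (s : Finset α) {T : Finset α}
    (h : M.IsBasis' ((T : Set α) ∩ (s : Set α)) (s : Set α)) : (s \ T).card = corank M s := by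
  have hcard : ((s ∩ T).card : ℕ∞) = M.eRk (s : Set α) := by
    rw [← h.encard_eq_eRk, ← Set.encard_coe_eq_coe_finsetCard]
    congr 1
    push_cast
    exact Set.inter_comm _ _
  have hnat : (s ∩ T).card = (M.eRk (s : Set α)).toNat := by
    rw [← hcard, ENat.toNat_coe]
  have h2 := Finset.card_sdiff_add_card_inter s T
  unfold corank
  omega

/-- **Tree with cycle AS PRINTED**: "it has a cycle and it becomes a 1-tree after deleting any line of this cycle" — a line set T′ containing a
circuit C such that T′∖{e} is a base for every e ∈ C. [cite: Volkov2020, §2.1 (journal p.7; tex l.154)] -/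
def IsTreeWithCycle (T' : Finset α) : Prop :=
  ∃ C : Finset α, C ⊆ T' ∧ M.IsCircuit (C : Set α) ∧ ∀ e ∈ C, M.IsBase ((T'.erase e : Finset α) : Set α)

variable {M}

/-- A tree with cycle is a 1-tree plus one line: picking any line e of its cycle, T′ = insert e (T′∖{e}) with T′∖{e} a base. [cite: Volkov2020, §2.1 (journal p.7; tex l.154)] -/
theorem IsTreeWithCycle.exists_eq_insert {T' : Finset α} (h : IsTreeWithCycle M T') :
    ∃ (C : Finset α) (e : α), C ⊆ T' ∧ M.IsCircuit (C : Set α) ∧ e ∈ C ∧ M.IsBase ((T'.erase e : Finset α) : Set α) ∧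
      T' = insert e (T'.erase e) := by
  obtain ⟨C, hCT, hC, hbase⟩ := h
  obtain ⟨e, he⟩ : C.Nonempty := by
    have := hC.nonempty
    exact_mod_cast this
  exact ⟨C, e, hCT, hC, he, hbase e he, (Finset.insert_erase (hCT he)).symm⟩

/-- "The cycle of T′": the cycle of a tree with cycle is its ONLY circuit (the fundamental circuit of the extra line over the 1-tree), which
is what makes the definite article of the printed proof meaningful. [cite: Volkov2020, §2.1 and proof of Lemma 3.3 («the cycle of T′»; journal p.7, p.11; tex l.154, l.356)] -/
theorem IsTreeWithCycle.circuit_unique {T' C C'' : Finset α} (hCT : C ⊆ T') (hC : M.IsCircuit (C : Set α))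
    {e : α} (he : e ∈ C) (hbase : M.IsBase ((T'.erase e : Finset α) : Set α))
    (hC''T : (C'' : Set α) ⊆ (T' : Set α)) (hC'' : M.IsCircuit (C'' : Set α)) : (C'' : Set α) = (C : Set α) := by
  have hT'eq : (T' : Set α) = insert e ((T'.erase e : Finset α) : Set α) := by
    rw [Finset.coe_erase, Set.insert_sdiff_singleton, Set.insert_eq_of_mem]
    exact_mod_cast hCT he
  have h1 := hC''.eq_fundCircuit_of_subset hbase.indep (hT'eq ▸ hC''T)
  have h2 := hC.eq_fundCircuit_of_subset hbase.indep (hT'eq ▸ (by exact_mod_cast hCT : (C : Set α) ⊆ (T' : Set α)))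
  rw [h1, h2]

/-- Lemma 3.3's "a_l ≥ −1": for a tree with cycle T′ and ANY line set s, |s| − rank(s) ≤ |s∖T′| + 1 ("T′ becomes acyclic in s^{[l]} after
removing j₁"). [cite: Volkov2020, proof of Lemma 3.3 (journal p.11; tex l.355–356)] -/
theorem corank_le_card_sdiff_add_one {T' : Finset α} (h : IsTreeWithCycle M T') (s : Finset α) :
    corank M s ≤ (s \ T').card + 1 := by
  obtain ⟨C, e, hCT, hC, he, hbase, hT'⟩ := h.exists_eq_insert
  have h1 := corank_le_card_sdiff M s hbase.indep
  have h2 : (s \ T'.erase e).card ≤ (s \ T').card + 1 := by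
    have hsub : s \ T'.erase e ⊆ insert e (s \ T') := by
      intro x hx
      rw [Finset.mem_sdiff, Finset.mem_erase] at hx
      rw [Finset.mem_insert, Finset.mem_sdiff]
      by_cases hxe : x = e
      · exact Or.inl hxe
      · exact Or.inr ⟨hx.1, fun hxT => hx.2 ⟨hxe, hxT⟩⟩
    exact (Finset.card_le_card hsub).trans (Finset.card_insert_le _ _)
  omega

/-- Lemma 3.3's "a_l ≥ 0": if the cycle of the tree with cycle T′ is NOT contained in s, then s ∩ T′ is acyclic and |s| − rank(s) ≤ |s∖T′|
("the cycle of T′ is not contained in s^{[l]}, i.e., T′ ∩ s^{[l]} is acyclic"). [cite: Volkov2020, proof of Lemma 3.3 (journal p.11; tex l.356–357)] -/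
theorem corank_le_card_sdiff_of_not_subset {T' C : Finset α} (hCT : C ⊆ T') (hC : M.IsCircuit (C : Set α))
    (hbase : ∀ e ∈ C, M.IsBase ((T'.erase e : Finset α) : Set α)) {s : Finset α} (hCs : ¬ C ⊆ s) :
    corank M s ≤ (s \ T').card := by
  obtain ⟨e, he⟩ : C.Nonempty := by
    have := hC.nonempty
    exact_mod_cast this
  have hbe := hbase e he
  -- s ∩ T′ is independent: a circuit inside it would be a circuit inside T′, hence = C ⊆ s.
  have hground : ((s ∩ T' : Finset α) : Set α) ⊆ M.E := by
    have hT'E : (T' : Set α) ⊆ M.E := by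
      intro x hx
      by_cases hxe : x = e
      · exact hxe ▸ hC.subset_ground (by exact_mod_cast he)
      · exact hbe.subset_ground (by rw [Finset.coe_erase]; exact ⟨hx, hxe⟩)
    exact Set.Subset.trans (by push_cast; exact Set.inter_subset_right) hT'E
  have hindep : M.Indep ((s ∩ T' : Finset α) : Set α) := by
    by_contra hdep
    have hdep' : M.Dep ((s ∩ T' : Finset α) : Set α) := ⟨hdep, hground⟩
    obtain ⟨C'', hC''sub, hC''⟩ := hdep'.exists_isCircuit_subset
    have hC''T : C'' ⊆ (T' : Set α) := hC''sub.trans (by push_cast; exact Set.inter_subset_right)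
    have hC''s : C'' ⊆ (s : Set α) := hC''sub.trans (by push_cast; exact Set.inter_subset_left)
    have hfin : C''.Finite := (Finset.finite_toSet (s ∩ T')).subset hC''sub
    have hC''eq : ((hfin.toFinset : Finset α) : Set α) = C'' := Set.Finite.coe_toFinset _
    have huniq := IsTreeWithCycle.circuit_unique hCT hC he hbe (C'' := hfin.toFinset)
      (by rw [hC''eq]; exact hC''T) (by rw [hC''eq]; exact hC'')
    rw [hC''eq] at huniq
    apply hCs
    intro x hx
    have : x ∈ (C : Set α) := by exact_mod_cast hx
    rw [← huniq] at this
    exact_mod_cast hC''s this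
  have := corank_le_card_sdiff M s hindep
  -- s \ (s ∩ T′) = s \ T′
  rwa [Finset.sdiff_inter_self_left] at this

end FinsetLevel

/-! ## 1-trees and Loop(s), for a matroid on a finite type of lines -/

section Loop

variable {α : Type*} [Fintype α] [DecidableEq α] (M : Matroid α)

/-- The 1-trees (spanning trees) of the graph = the bases of its cycle matroid, as a finset of finsets of lines ("T runs over all 1-trees
of G"). [cite: Volkov2020, §2.1 (journal p.7; tex l.150–157)] -/
def oneTrees : Finset (Finset α) :=
  open Classical in univ.filter fun T : Finset α => M.IsBase (T : Set α)

omit [DecidableEq α] in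
/-- Membership in `oneTrees` is being a base (1-tree). [cite: Volkov2020, §2.1 (journal p.7)] -/
theorem mem_oneTrees {T : Finset α} : T ∈ oneTrees M ↔ M.IsBase (T : Set α) := by
  classical
  unfold oneTrees
  simp only [Finset.mem_filter, Finset.mem_univ, true_and]

omit [DecidableEq α] in
/-- Every base of a matroid on a finite type is (the coercion of) a member of `oneTrees`. [folklore] -/
private theorem exists_mem_oneTrees_coe_eq {B : Set α} (hB : M.IsBase B) :
    ∃ T ∈ oneTrees M, (T : Set α) = B := by
  refine ⟨(Set.toFinite B).toFinset, (mem_oneTrees M).2 ?_, Set.Finite.coe_toFinset _⟩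
  rwa [Set.Finite.coe_toFinset]

omit [DecidableEq α] in
/-- There is at least one 1-tree (every matroid has a base) — presupposed by "the minimum of |s∖T|, where T runs over all 1-trees of G".
[cite: Volkov2020, §2.1 (journal p.7; tex l.157)] -/
theorem oneTrees_nonempty : (oneTrees M).Nonempty := by
  obtain ⟨B, hB⟩ := M.exists_isBase
  obtain ⟨T, hT, -⟩ := exists_mem_oneTrees_coe_eq M hB
  exact ⟨T, hT⟩

/-- **Loop(s) AS PRINTED**: "by Loop(s) we denote the minimum of |s∖T|, where T runs over all 1-trees of G."
[cite: Volkov2020, §2.1 (journal p.7; tex l.157)] -/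
def loopNum (s : Finset α) : ℕ :=
  ((oneTrees M).image fun T => (s \ T).card).min' ((oneTrees_nonempty M).image _)

/-- Loop(s) ≤ |s∖T| for every 1-tree T (it is the minimum). [cite: Volkov2020, §2.1 (journal p.7; tex l.157)] -/
theorem loopNum_le (s : Finset α) {T : Finset α} (hT : M.IsBase (T : Set α)) : loopNum M s ≤ (s \ T).card :=
  Finset.min'_le _ _ (mem_image_of_mem _ ((mem_oneTrees M).2 hT))

/-- The minimum Loop(s) is attained at some 1-tree. [cite: Volkov2020, §2.1 (journal p.7; tex l.157)] -/
theorem exists_card_sdiff_eq_loopNum (s : Finset α) :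
    ∃ T : Finset α, M.IsBase (T : Set α) ∧ (s \ T).card = loopNum M s := by
  have h := Finset.min'_mem _ ((oneTrees_nonempty M).image fun T => (s \ T).card)
  obtain ⟨T, hT, hTeq⟩ := mem_image.1 h
  exact ⟨T, (mem_oneTrees M).1 hT, hTeq⟩

/-- Some 1-tree attains |s∖T| = |s| − rank(s) (extend a maximal acyclic subset of s to a 1-tree). [cite: Volkov2020, proof of Lemma 3.2 (journal p.11)] -/
theorem exists_isBase_card_sdiff_eq_corank (s : Finset α) :
    ∃ T : Finset α, M.IsBase (T : Set α) ∧ (s \ T).card = corank M s := by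
  obtain ⟨I, hI⟩ := M.exists_isBasis' (s : Set α)
  obtain ⟨B, hB, hIB⟩ := hI.indep.exists_isBase_superset
  obtain ⟨T, hT, hTB⟩ := exists_mem_oneTrees_coe_eq M hB
  refine ⟨T, (mem_oneTrees M).1 hT, card_sdiff_eq_corank_of_isBasis' M s ?_⟩
  have heq : I = (T : Set α) ∩ (s : Set α) :=
    hI.eq_of_subset_indep (hB.indep.subset (hTB ▸ Set.inter_subset_left))
      (Set.subset_inter (hTB ▸ hIB) hI.subset) Set.inter_subset_right
  rwa [← heq]

/-- **Loop(s) = |s| − rank(s)**: Volkov's Loop (a minimum over 1-trees) is Panzer's corank ℓ(s) ("loop number"; for the cycle matroid of a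
graph the first Betti number of s). [cite: Volkov2020, §2.1 (journal p.7; tex l.157)] -/
theorem loopNum_eq_corank (s : Finset α) : loopNum M s = corank M s := by
  apply le_antisymm
  · obtain ⟨T, hT, hTeq⟩ := exists_isBase_card_sdiff_eq_corank M s
    exact hTeq ▸ loopNum_le M s hT
  · refine Finset.le_min' _ _ _ fun n hn => ?_
    obtain ⟨T, hT, rfl⟩ := mem_image.1 hn
    exact corank_le_card_sdiff M s ((mem_oneTrees M).1 hT).indep

/-- Loop(∅) = 0 (the empty set is the one proper line set with ω = 0 allowed by the standing hypothesis "ω(s) < 0 for all s ⊆ E(G) except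
the empty set and E(G)"). [cite: Volkov2020, §2.1 (journal p.7; tex l.157–164)] -/
@[simp] theorem loopNum_empty : loopNum M ∅ = 0 := by
  rw [loopNum_eq_corank, corank_empty]

/-- All 1-trees have the same number of lines, so |E∖T| = Loop(E) for EVERY 1-tree T (the exponent of t₁ in Lemmas 3.2/3.3 never
varies; Volkov: "we ignore the multiplier containing t₁"). [cite: Volkov2020, §2.1 and Theorem 3.1's remark (journal p.7, p.17)] -/
theorem card_univ_sdiff_eq_loopNum {T : Finset α} (hT : M.IsBase (T : Set α)) :
    (univ \ T).card = loopNum M univ := by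
  obtain ⟨T', hT', hT'eq⟩ := exists_card_sdiff_eq_loopNum M univ
  have hc : T.card = T'.card := by
    have := hT.ncard_eq_ncard_of_isBase hT'
    simpa [Set.ncard_coe_finset] using this
  have h1 := Finset.card_sdiff_add_card_inter univ T
  have h2 := Finset.card_sdiff_add_card_inter univ T'
  rw [Finset.univ_inter] at h1 h2
  omega

variable {M}

/-- A line set containing a cycle is dependent, so its Loop is ≥ 1 (used silently in the printed "a_l ≥ −1": the exponent
|s^{[l]}∖T′| = Loop(s^{[l]}) + a_l is a natural number). [cite: Volkov2020, proof of Lemma 3.3 (journal p.11; tex l.355–356)] -/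
theorem one_le_corank_of_circuit_subset {C s : Finset α} (hC : M.IsCircuit (C : Set α)) (hCs : C ⊆ s) :
    1 ≤ corank M s := by
  obtain ⟨T, hT, hTeq⟩ := exists_isBase_card_sdiff_eq_corank M s
  rw [← hTeq]
  by_contra hlt
  have h0 : s \ T = ∅ := Finset.card_eq_zero.1 (by omega)
  have hsT : s ⊆ T := by
    intro x hx
    by_contra hxT
    have : x ∈ s \ T := Finset.mem_sdiff.2 ⟨hx, hxT⟩
    rw [h0] at this
    simp at this
  exact hC.not_indep (hT.indep.subset (by exact_mod_cast hCs.trans hsT))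

/-- Non-vacuity / the converse reading: a 1-tree T plus any further line e of the ground set IS a tree with cycle (its cycle = the
fundamental circuit of e over T; deleting any line of it is a basis exchange). [cite: Volkov2020, §2.1 (journal p.7; tex l.154)] -/
theorem isTreeWithCycle_insert {T : Finset α} (hT : M.IsBase (T : Set α)) {e : α} (he : e ∈ M.E) (heT : e ∉ T) :
    IsTreeWithCycle M (insert e T) := by
  have hecl : e ∈ M.closure (T : Set α) := by rw [hT.closure_eq]; exact he
  have heT' : e ∉ (T : Set α) := by exact_mod_cast heT
  have hcirc := hT.indep.fundCircuit_isCircuit hecl heT'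
  set C : Set α := M.fundCircuit e (T : Set α) with hCdef
  have hfin : C.Finite := Set.toFinite C
  refine ⟨hfin.toFinset, ?_, by rwa [Set.Finite.coe_toFinset], fun f hf => ?_⟩
  · intro x hx
    rw [Set.Finite.mem_toFinset] at hx
    have := M.fundCircuit_subset_insert e (T : Set α) hx
    rw [Finset.mem_insert]
    rcases this with hxe | hxT
    · exact Or.inl hxe
    · exact Or.inr (by exact_mod_cast hxT)
  · rw [Set.Finite.mem_toFinset] at hf
    by_cases hfe : f = e
    · subst hfe
      rwa [Finset.erase_insert heT]
    · have hind : M.Indep (insert e (T : Set α) \ {f}) := (hT.indep.mem_fundCircuit_iff hecl heT').1 hf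
      have hset : insert e (T : Set α) \ {f} = insert e ((T : Set α) \ {f}) := by
        ext x
        simp only [Set.mem_sdiff, Set.mem_insert_iff, Set.mem_singleton_iff]
        constructor
        · rintro ⟨hx | hx, hxf⟩
          · exact Or.inl hx
          · exact Or.inr ⟨hx, hxf⟩
        · rintro (hx | ⟨hx, hxf⟩)
          · exact ⟨Or.inl hx, fun h => hfe (by rw [← h]; exact hx)⟩
          · exact ⟨Or.inr hx, hxf⟩
      have hbase := hT.exchange_isBase_of_indep (e := f) (f := e) heT' (hset ▸ hind)
      rw [Finset.erase_insert_of_ne (fun h => hfe h.symm)]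
      push_cast
      exact hbase

variable (M)

/-- The trees with cycle "containing l₁ and l₂ on the cycle" — the index set of the sum defining B_{l₁l₂}(z). [cite: Volkov2020, §2.2.1 eq. (2.3) (journal p.8–9; tex l.226–232)] -/
def cycleTrees (j₁ j₂ : α) : Finset (Finset α) :=
  open Classical in univ.filter fun T' : Finset α =>
    ∃ C : Finset α, C ⊆ T' ∧ M.IsCircuit (C : Set α) ∧ (∀ e ∈ C, M.IsBase ((T'.erase e : Finset α) : Set α)) ∧
      j₁ ∈ C ∧ j₂ ∈ C

/-- Membership in `cycleTrees`: a tree with cycle whose cycle passes through j₁ and j₂. [cite: Volkov2020, §2.2.1 eq. (2.3) (journal p.8–9)] -/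
theorem mem_cycleTrees {j₁ j₂ : α} {T' : Finset α} :
    T' ∈ cycleTrees M j₁ j₂ ↔ ∃ C : Finset α, C ⊆ T' ∧ M.IsCircuit (C : Set α) ∧
      (∀ e ∈ C, M.IsBase ((T'.erase e : Finset α) : Set α)) ∧ j₁ ∈ C ∧ j₂ ∈ C := by
  classical
  unfold cycleTrees
  simp only [Finset.mem_filter, Finset.mem_univ, true_and]

end Loop

/-! ## Hepp-sector coordinates (lines numbered along the sector) and Lemma 3.1 -/

section Hepp

variable {L : ℕ}

/-- `s^{[l]}`: the lines from position `l` on, `{k : Fin L | l ≤ k}` (Volkov's s^{[l]} = {j_l,…,j_L} is our `suffix L (l−1)`; `suffix L 0` = all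
lines, `suffix L L = ∅`). [cite: Volkov2020, §3.1 (journal p.10; tex l.296)] -/
def suffix (L : ℕ) (l : ℕ) : Finset (Fin L) := univ.filter fun k : Fin L => l ≤ (k : ℕ)

/-- Membership in `suffix`. [cite: Volkov2020, §3.1 (tex l.296)] -/
@[simp] theorem mem_suffix {l : ℕ} {k : Fin L} : k ∈ suffix L l ↔ l ≤ (k : ℕ) := by
  simp [suffix]

/-- `suffix L 0` is the whole line set E(G). [cite: Volkov2020, §3.1 (tex l.296)] -/
@[simp] theorem suffix_zero : suffix L 0 = univ := by
  ext k; simp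

/-- The suffixes decrease: l ≤ l′ ⇒ s^{[l′]} ⊆ s^{[l]}. [cite: Volkov2020, §3.1 (tex l.296)] -/
theorem suffix_antitone {l l' : ℕ} (h : l ≤ l') : suffix L l' ⊆ suffix L l := by
  intro k hk
  rw [mem_suffix] at hk ⊢
  exact h.trans hk

/-- Beyond the last line the suffix is empty. [cite: Volkov2020, §3.1 (tex l.296)] -/
theorem suffix_eq_empty {l : ℕ} (h : L ≤ l) : suffix L l = ∅ := by
  ext k
  simp only [mem_suffix, Finset.notMem_empty, iff_false, not_le]
  exact k.isLt.trans_le h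

/-- **The sector variables' inverse map**: `z_k = t_0 · t_1 ⋯ t_k` ("z_{j_l} = t₁t₂…t_l", the display in the proof of Lemma 3.1; equivalently
t₁ = z_{j₁}, t_l = z_{j_l}/z_{j_{l−1}}). [cite: Volkov2020, §3.1 and proof of Lemma 3.1 (journal p.10–11; tex l.296–312)] -/
def heppZ {R : Type*} [CommMonoid R] (t : Fin L → R) (k : Fin L) : R :=
  ∏ i ∈ univ.filter (fun i : Fin L => (i : ℕ) ≤ (k : ℕ)), t i

/-- `heppZ` recovers the printed ratios: z_k = t_k · z_{k−1} for k ≥ 1, and z_0 = t_0. [cite: Volkov2020, §3.1 (tex l.296–300)] -/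
theorem heppZ_succ {R : Type*} [CommMonoid R] (t : Fin L → R) (k : Fin L) (hk : (k : ℕ) + 1 < L) :
    heppZ t ⟨(k : ℕ) + 1, hk⟩ = t ⟨(k : ℕ) + 1, hk⟩ * heppZ t k := by
  unfold heppZ
  have hsplit : univ.filter (fun i : Fin L => (i : ℕ) ≤ (k : ℕ) + 1) =
      insert ⟨(k : ℕ) + 1, hk⟩ (univ.filter fun i : Fin L => (i : ℕ) ≤ (k : ℕ)) := by
    ext i
    simp only [Finset.mem_filter, Finset.mem_univ, true_and, Finset.mem_insert, Fin.ext_iff]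
    omega
  rw [hsplit, Finset.prod_insert]
  simp [Fin.lt_def]

/-- `z_0 = t_0` ("t₁ = z_{j₁}"). [cite: Volkov2020, §3.1 (tex l.298)] -/
theorem heppZ_zero {R : Type*} [CommMonoid R] (t : Fin L → R) (hL : 0 < L) : heppZ t ⟨0, hL⟩ = t ⟨0, hL⟩ := by
  unfold heppZ
  have : univ.filter (fun i : Fin L => (i : ℕ) ≤ ((⟨0, hL⟩ : Fin L) : ℕ)) = {⟨0, hL⟩} := by
    ext i
    simp only [Finset.mem_filter, Finset.mem_univ, true_and, Finset.mem_singleton, Fin.ext_iff]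
    omega
  rw [this, Finset.prod_singleton]

/-- In a field: "t_l = z_{j_l}/z_{j_{l−1}}" whenever z_{k−1} ≠ 0. [cite: Volkov2020, §3.1 (journal p.10; tex l.296–300)] -/
theorem heppZ_ratio {K : Type*} [Field K] (t : Fin L → K) (k : Fin L) (hk : (k : ℕ) + 1 < L) (hz : heppZ t k ≠ 0) :
    t ⟨(k : ℕ) + 1, hk⟩ = heppZ t ⟨(k : ℕ) + 1, hk⟩ / heppZ t k := by
  rw [heppZ_succ t k hk, mul_div_assoc, div_self hz, mul_one]

/-- **Lemma 3.1** (the Hepp-sector monomial identity): for every line set A, `∏_{k∈A} z_k = ∏_k t_k^{|A ∩ s^{[k]}|}` — printed for A = E(G)∖T: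
"∏_{l∈E(G)∖T} z_l = ∏_{l=1}^{L} t_l^{|s^{[l]}∖T|}". [cite: Volkov2020, Lemma 3.1 (journal p.11; tex l.304–314)] -/
theorem prod_heppZ_eq {R : Type*} [CommMonoid R] (t : Fin L → R) (A : Finset (Fin L)) :
    ∏ k ∈ A, heppZ t k = ∏ i : Fin L, t i ^ (A ∩ suffix L i).card := by
  unfold heppZ
  simp_rw [Finset.prod_filter]
  rw [Finset.prod_comm]
  refine Finset.prod_congr rfl fun i _ => ?_
  rw [← Finset.prod_filter, Finset.prod_const]
  congr 1
  congr 1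
  ext k
  simp [mem_suffix]

/-- Lemma 3.1 as printed, for the complement of a line set T: `∏_{k∉T} z_k = ∏_k t_k^{|s^{[k]}∖T|}`. [cite: Volkov2020, Lemma 3.1 (journal p.11; tex l.304–314)] -/
theorem prod_heppZ_compl_eq {R : Type*} [CommMonoid R] (t : Fin L → R) (T : Finset (Fin L)) :
    ∏ k ∈ univ \ T, heppZ t k = ∏ i : Fin L, t i ^ (suffix L i \ T).card := by
  rw [prod_heppZ_eq]
  refine Finset.prod_congr rfl fun i _ => ?_
  congr 2
  ext k
  simp only [Finset.mem_inter, Finset.mem_sdiff, Finset.mem_univ, true_and, mem_suffix]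
  tauto

/-! ## D(z) and Lemma 3.2 in both directions -/

/-- **D(z) AS PRINTED**: `D(z) = Σ_T ∏_{l∈E(G)∖T} z_l`, "the summation goes over all 1-trees in G" (for a matroid: over its bases; for a
connected graph the first Symanzik polynomial). [cite: Volkov2020, §2.2.1 (journal p.8; tex l.213–218)] -/
def treeSum {R : Type*} [CommSemiring R] (M : Matroid (Fin L)) (z : Fin L → R) : R :=
  ∑ T ∈ oneTrees M, ∏ k ∈ univ \ T, z k

/-- D in the sector variables, term by term (Lemma 3.1 applied to every 1-tree). [cite: Volkov2020, Lemmas 3.1–3.2 (journal p.11)] -/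
theorem treeSum_heppZ {R : Type*} [CommSemiring R] (M : Matroid (Fin L)) (t : Fin L → R) :
    treeSum M (heppZ t) = ∑ T ∈ oneTrees M, ∏ i : Fin L, t i ^ (suffix L i \ T).card := by
  unfold treeSum
  exact Finset.sum_congr rfl fun T _ => prod_heppZ_compl_eq t T

/-- **The nested 1-tree for the sector's suffixes**: "there exists a 1-tree T such that |s^{[l]}∖T| = Loop(s^{[l]}) for all l."
[cite: Volkov2020, proof of Lemma 3.2 (journal p.11; tex l.323–325)] -/
theorem exists_isBase_suffix_nested (M : Matroid (Fin L)) :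
    ∃ T : Finset (Fin L), M.IsBase (T : Set (Fin L)) ∧ ∀ l : ℕ, (suffix L l \ T).card = loopNum M (suffix L l) := by
  -- the increasing chain X m = s^{[L − m]}, m = 0, …, L
  set X : ℕ → Set (Fin L) := fun m => ((suffix L (L - m) : Finset (Fin L)) : Set (Fin L)) with hXdef
  have hX : Monotone X := by
    intro m m' hmm'
    simp only [hXdef]
    exact_mod_cast suffix_antitone (L := L) (Nat.sub_le_sub_left hmm' L)
  obtain ⟨B, hB, hnest⟩ := exists_isBase_nested M X hX L
  obtain ⟨T, hT, hTB⟩ := exists_mem_oneTrees_coe_eq M hB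
  refine ⟨T, (mem_oneTrees M).1 hT, fun l => ?_⟩
  rw [loopNum_eq_corank]
  rcases Nat.lt_or_ge l L with hl | hl
  · have hm : L - (L - l) = l := Nat.sub_sub_self hl.le
    have h := hnest (L - l) (Nat.sub_le L l)
    simp only [hXdef, hm] at h
    exact card_sdiff_eq_corank_of_isBasis' M _ (hTB ▸ h)
  · rw [suffix_eq_empty hl, corank_empty]
    simp

/-- **Lemma 3.2, lower bound with C = 1**: for sector variables t ≥ 0 (no upper bound needed),
`∏_k t_k^{Loop(s^{[k]})} ≤ D(z(t))` — the printed "D(z) ≥ C ∏_{l=1}^{L} t_l^{Loop(s^{[l]})}". [cite: Volkov2020, Lemma 3.2 (journal p.11; tex l.316–325)] -/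
theorem prod_pow_loopNum_le_treeSum (M : Matroid (Fin L)) (t : Fin L → ℝ) (ht : ∀ k, 0 ≤ t k) :
    ∏ i : Fin L, t i ^ loopNum M (suffix L i) ≤ treeSum M (heppZ t) := by
  rw [treeSum_heppZ]
  obtain ⟨T, hT, hnest⟩ := exists_isBase_suffix_nested M
  have hterm : ∏ i : Fin L, t i ^ loopNum M (suffix L i) = ∏ i : Fin L, t i ^ (suffix L i \ T).card :=
    Finset.prod_congr rfl fun i _ => by rw [hnest i]
  rw [hterm]
  refine Finset.single_le_sum (f := fun T : Finset (Fin L) => ∏ i : Fin L, t i ^ (suffix L i \ T).card)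
    (fun T' _ => Finset.prod_nonneg fun i _ => pow_nonneg (ht i) _) ((mem_oneTrees M).2 hT)

/-- **Lemma 3.2, upper bound** (footnote 22: "the sign ≥ can be changed to ≤"): in the sector, i.e. for 0 ≤ t with t_k ≤ 1 for k ≥ 1
(t_0 = the largest parameter is unconstrained), `D(z(t)) ≤ (#1-trees) · ∏_k t_k^{Loop(s^{[k]})}`. [cite: Volkov2020, Lemma 3.2 fn 22 (journal p.11; tex l.317)] -/
theorem treeSum_le_card_mul_prod_pow_loopNum (M : Matroid (Fin L)) (t : Fin L → ℝ) (ht0 : ∀ k, 0 ≤ t k)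
    (ht1 : ∀ k : Fin L, 0 < (k : ℕ) → t k ≤ 1) :
    treeSum M (heppZ t) ≤ (oneTrees M).card * ∏ i : Fin L, t i ^ loopNum M (suffix L i) := by
  rw [treeSum_heppZ, ← nsmul_eq_mul]
  refine Finset.sum_le_card_nsmul _ _ _ fun T hT => ?_
  have hTb := (mem_oneTrees M).1 hT
  refine Finset.prod_le_prod (fun i _ => pow_nonneg (ht0 i) _) fun i _ => ?_
  rcases Nat.eq_zero_or_pos (i : ℕ) with hi | hi
  · -- the exponent of t₀ is Loop(E(G)) for every 1-tree
    have hs : suffix L i = univ := by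
      ext k; simp [hi]
    rw [hs, card_univ_sdiff_eq_loopNum M hTb]
  · exact pow_le_pow_of_le_one (ht0 i) (ht1 i hi) (loopNum_le M _ hTb)

/-- **Lemma 3.2 as printed** (∃ C > 0, depending only on the matroid): `C · ∏ t_l^{Loop(s^{[l]})} ≤ D(z)` on the closed sector.
[cite: Volkov2020, Lemma 3.2 (journal p.11; tex l.316–321)] -/
theorem lemma32 (M : Matroid (Fin L)) :
    ∃ C : ℝ, 0 < C ∧ ∀ t : Fin L → ℝ, (∀ k, 0 ≤ t k) →
      C * ∏ i : Fin L, t i ^ loopNum M (suffix L i) ≤ treeSum M (heppZ t) :=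
  ⟨1, one_pos, fun t ht => by rw [one_mul]; exact prod_pow_loopNum_le_treeSum M t ht⟩

/-- Lemma 3.2 with footnote 22, two-sided: `C₁ ∏ t^{Loop} ≤ D ≤ C₂ ∏ t^{Loop}` on the sector with C₁ = 1, C₂ = #1-trees.
[cite: Volkov2020, Lemma 3.2 with fn 22 (journal p.11; tex l.316–325)] -/
theorem lemma32_two_sided (M : Matroid (Fin L)) (t : Fin L → ℝ) (ht0 : ∀ k, 0 ≤ t k)
    (ht1 : ∀ k : Fin L, 0 < (k : ℕ) → t k ≤ 1) :
    ∏ i : Fin L, t i ^ loopNum M (suffix L i) ≤ treeSum M (heppZ t) ∧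
      treeSum M (heppZ t) ≤ (oneTrees M).card * ∏ i : Fin L, t i ^ loopNum M (suffix L i) :=
  ⟨prod_pow_loopNum_le_treeSum M t ht0, treeSum_le_card_mul_prod_pow_loopNum M t ht0 ht1⟩

/-! ## Lemma 3.3: the monomial of a tree with cycle in the sector -/

/-- **Lemma 3.3's per-tuple bound**: for a tree with cycle T′ with lines j₁, j₂ on its cycle, in the sector (0 ≤ t, t_k ≤ 1 for k ≥ 1)
`∏_{k∉T′} z_k ≤ ∏_k t_k^{Loop(s^{[k]}) − [j₁ ∈ s^{[k]} ∧ j₂ ∈ s^{[k]}]}` — i.e. the contribution ∏ t_k^{|s^{[k]}∖T′|} has exponents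
a_k + Loop(s^{[k]}) with "a_l ≥ −1 if j₁, j₂ ∈ s^{[l]}" and "a_l ≥ 0" otherwise. [cite: Volkov2020, proof of Lemma 3.3 (journal p.11; tex l.345–358)] -/
theorem prod_heppZ_treeWithCycle_le (M : Matroid (Fin L)) {T' C : Finset (Fin L)} (hCT : C ⊆ T')
    (hC : M.IsCircuit (C : Set (Fin L))) (hbase : ∀ e ∈ C, M.IsBase ((T'.erase e : Finset (Fin L)) : Set (Fin L)))
    {j₁ j₂ : Fin L} (hj₁ : j₁ ∈ C) (hj₂ : j₂ ∈ C)
    (t : Fin L → ℝ) (ht0 : ∀ k, 0 ≤ t k) (ht1 : ∀ k : Fin L, 0 < (k : ℕ) → t k ≤ 1) :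
    ∏ k ∈ univ \ T', heppZ t k ≤
      ∏ i : Fin L, t i ^ (loopNum M (suffix L i) - if j₁ ∈ suffix L i ∧ j₂ ∈ suffix L i then 1 else 0) := by
  have hTWC : IsTreeWithCycle M T' := ⟨C, hCT, hC, hbase⟩
  rw [prod_heppZ_compl_eq]
  refine Finset.prod_le_prod (fun i _ => pow_nonneg (ht0 i) _) fun i _ => ?_
  -- the exponent inequality  Loop(s) − [j₁,j₂ ∈ s] ≤ |s ∖ T′|  for s = suffix L i
  have hexp : loopNum M (suffix L i) - (if j₁ ∈ suffix L i ∧ j₂ ∈ suffix L i then 1 else 0) ≤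
      (suffix L i \ T').card := by
    rw [loopNum_eq_corank]
    split_ifs with hboth
    · have := corank_le_card_sdiff_add_one hTWC (suffix L i)
      omega
    · have hCs : ¬ C ⊆ suffix L i := by
        intro hsub
        exact hboth ⟨hsub hj₁, hsub hj₂⟩
      have := corank_le_card_sdiff_of_not_subset hCT hC hbase hCs
      omega
  rcases Nat.eq_zero_or_pos (i : ℕ) with hi | hi
  · -- at the top level s^{[1]} = E(G): |E∖T′| = Loop(E) − 1 exactly, and j₁, j₂ ∈ E
    have hs : suffix L i = univ := by
      ext k; simp [hi]
    obtain ⟨C', e, hCT', hC', he, hbe, hT'eq⟩ := hTWC.exists_eq_insert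
    have hcard : (univ \ T').card + 1 = loopNum M univ := by
      rw [← card_univ_sdiff_eq_loopNum M hbe]
      have heT : e ∉ T'.erase e := Finset.notMem_erase e T'
      have h1 := Finset.card_sdiff_add_card_inter univ T'
      have h2 := Finset.card_sdiff_add_card_inter univ (T'.erase e)
      rw [Finset.univ_inter] at h1 h2
      have h3 : T'.card = (T'.erase e).card + 1 := by
        rw [Finset.card_erase_of_mem (hCT' he)]
        have : 0 < T'.card := Finset.card_pos.2 ⟨e, hCT' he⟩
        omega
      omega
    have hexp0 : loopNum M (suffix L i) - (if j₁ ∈ suffix L i ∧ j₂ ∈ suffix L i then 1 else 0) =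
        (suffix L i \ T').card := by
      rw [hs]
      simp only [Finset.mem_univ, and_self, if_true]
      omega
    rw [hexp0]
  · exact pow_le_pow_of_le_one (ht0 i) (ht1 i hi) hexp

/-! ## Lemma 3.3 assembled: |K(z)| in the sector -/

/-- **B_{l₁l₂}(z) AS PRINTED, with abstract signs**: `Σ_{T′} c(T′) ∏_{l∉T′} z_l` over the trees with cycle through l₁, l₂; in print
c(T′) = ±1 according to the orientation of l₁, l₂ on the cycle — a graph datum; the bound below uses only |c(T′)| ≤ 1.
[cite: Volkov2020, §2.2.1 eq. (2.3) (journal p.8–9; tex l.226–232)] -/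
def cycleSum (M : Matroid (Fin L)) (c : Finset (Fin L) → ℝ) (j₁ j₂ : Fin L) (z : Fin L → ℝ) : ℝ :=
  ∑ T' ∈ cycleTrees M j₁ j₂, c T' * ∏ k ∈ univ \ T', z k

/-- **K(z) AS PRINTED**: "K(z) contains all global multipliers (1/D(z)²) and (B_{l₁l₂}(z)/D(z)) of the construction" — one factor B/D per
pair of the pairing P. [cite: Volkov2020, §3.1 eq. (3.1) (journal p.10; tex l.280–286)] -/
def kFactor (M : Matroid (Fin L)) (P : Finset (Fin L × Fin L)) (c : Fin L × Fin L → Finset (Fin L) → ℝ) (z : Fin L → ℝ) : ℝ :=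
  (treeSum M z)⁻¹ ^ 2 * ∏ p ∈ P, cycleSum M (c p) p.1 p.2 z / treeSum M z

/-- `|P[s]|`: the number of pairs of P contained in s ("P[s] = {a ∈ P : a ⊆ s}"). [cite: Volkov2020, §3.1 (journal p.10; tex l.290–294)] -/
def pairsIn (P : Finset (Fin L × Fin L)) (s : Finset (Fin L)) : ℕ :=
  (P.filter fun p => p.1 ∈ s ∧ p.2 ∈ s).card

/-- In the open sector all Feynman parameters are positive. [cite: Volkov2020, §3.1 (journal p.10)] -/
theorem heppZ_pos (t : Fin L → ℝ) (ht : ∀ k, 0 < t k) (k : Fin L) : 0 < heppZ t k :=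
  Finset.prod_pos fun i _ => ht i

/-- In the closed sector all Feynman parameters are nonnegative. [cite: Volkov2020, §3.1 (journal p.10)] -/
theorem heppZ_nonneg (t : Fin L → ℝ) (ht : ∀ k, 0 ≤ t k) (k : Fin L) : 0 ≤ heppZ t k :=
  Finset.prod_nonneg fun i _ => ht i

/-- Lemma 3.2's monomial is positive in the open sector, hence so is D. [cite: Volkov2020, Lemma 3.2 (journal p.11)] -/
theorem treeSum_pos (M : Matroid (Fin L)) (t : Fin L → ℝ) (ht : ∀ k, 0 < t k) : 0 < treeSum M (heppZ t) :=
  lt_of_lt_of_le (Finset.prod_pos fun i _ => pow_pos (ht i) _) (prod_pow_loopNum_le_treeSum M t fun k => (ht k).le)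

/-- The per-tuple bound of Lemma 3.3 in product form: for a tree with cycle T′ through j₁, j₂,
`(∏_{k∉T′} z_k) · ∏_k t_k^{[j₁, j₂ ∈ s^{[k]}]} ≤ ∏_k t_k^{Loop(s^{[k]})}` in the sector — "a_l ≥ −1 if j₁, j₂ ∈ s^{[l]}", "a_l ≥ 0" otherwise,
with equality of exponents at the top level. [cite: Volkov2020, proof of Lemma 3.3 (journal p.11; tex l.345–358)] -/
theorem prod_heppZ_treeWithCycle_mul_le (M : Matroid (Fin L)) {T' C : Finset (Fin L)} (hCT : C ⊆ T')
    (hC : M.IsCircuit (C : Set (Fin L))) (hbase : ∀ e ∈ C, M.IsBase ((T'.erase e : Finset (Fin L)) : Set (Fin L)))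
    {j₁ j₂ : Fin L} (hj₁ : j₁ ∈ C) (hj₂ : j₂ ∈ C)
    (t : Fin L → ℝ) (ht0 : ∀ k, 0 ≤ t k) (ht1 : ∀ k : Fin L, 0 < (k : ℕ) → t k ≤ 1) :
    (∏ k ∈ univ \ T', heppZ t k) * ∏ i : Fin L, t i ^ (if j₁ ∈ suffix L i ∧ j₂ ∈ suffix L i then 1 else 0) ≤
      ∏ i : Fin L, t i ^ loopNum M (suffix L i) := by
  have hTWC : IsTreeWithCycle M T' := ⟨C, hCT, hC, hbase⟩
  rw [prod_heppZ_compl_eq, ← Finset.prod_mul_distrib]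
  refine Finset.prod_le_prod (fun i _ => mul_nonneg (pow_nonneg (ht0 i) _) (pow_nonneg (ht0 i) _)) fun i _ => ?_
  rw [← pow_add]
  -- the exponent inequality  Loop(s) ≤ |s ∖ T′| + [j₁,j₂ ∈ s]  for s = suffix L i
  have hexp : loopNum M (suffix L i) ≤
      (suffix L i \ T').card + (if j₁ ∈ suffix L i ∧ j₂ ∈ suffix L i then 1 else 0) := by
    rw [loopNum_eq_corank]
    split_ifs with hboth
    · exact corank_le_card_sdiff_add_one hTWC (suffix L i)
    · have hCs : ¬ C ⊆ suffix L i := fun hsub => hboth ⟨hsub hj₁, hsub hj₂⟩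
      simpa using corank_le_card_sdiff_of_not_subset hCT hC hbase hCs
  rcases Nat.eq_zero_or_pos (i : ℕ) with hi | hi
  · -- at the top level s^{[1]} = E(G): |E∖T′| + 1 = Loop(E) exactly
    have hs : suffix L i = univ := by
      ext k; simp [hi]
    obtain ⟨C', e, hCT', hC', he, hbe, hT'eq⟩ := hTWC.exists_eq_insert
    have hcard : (univ \ T').card + 1 = loopNum M univ := by
      rw [← card_univ_sdiff_eq_loopNum M hbe]
      have h1 := Finset.card_sdiff_add_card_inter univ T'
      have h2 := Finset.card_sdiff_add_card_inter univ (T'.erase e)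
      rw [Finset.univ_inter] at h1 h2
      have h3 : T'.card = (T'.erase e).card + 1 := by
        rw [Finset.card_erase_of_mem (hCT' he)]
        have : 0 < T'.card := Finset.card_pos.2 ⟨e, hCT' he⟩
        omega
      omega
    rw [hs]
    simp only [Finset.mem_univ, and_self, if_true]
    rw [hcard]
  · exact pow_le_pow_of_le_one (ht0 i) (ht1 i hi) hexp

/-- |B_{j₁j₂}(z)| · ∏_k t_k^{[j₁,j₂ ∈ s^{[k]}]} ≤ (#trees with cycle through j₁,j₂) · ∏_k t_k^{Loop(s^{[k]})} in the sector, for any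
coefficients with |c(T′)| ≤ 1 (Lemma 3.3's per-tuple bound summed over T′). [cite: Volkov2020, proof of Lemma 3.3 (journal p.11; tex l.345–358)] -/
theorem abs_cycleSum_mul_le (M : Matroid (Fin L)) (c : Finset (Fin L) → ℝ) (hc : ∀ T', |c T'| ≤ 1) (j₁ j₂ : Fin L)
    (t : Fin L → ℝ) (ht0 : ∀ k, 0 ≤ t k) (ht1 : ∀ k : Fin L, 0 < (k : ℕ) → t k ≤ 1) :
    |cycleSum M c j₁ j₂ (heppZ t)| * ∏ i : Fin L, t i ^ (if j₁ ∈ suffix L i ∧ j₂ ∈ suffix L i then 1 else 0) ≤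
      (cycleTrees M j₁ j₂).card * ∏ i : Fin L, t i ^ loopNum M (suffix L i) := by
  set δ : ℝ := ∏ i : Fin L, t i ^ (if j₁ ∈ suffix L i ∧ j₂ ∈ suffix L i then 1 else 0) with hδ
  have hδ0 : 0 ≤ δ := Finset.prod_nonneg fun i _ => pow_nonneg (ht0 i) _
  unfold cycleSum
  calc |∑ T' ∈ cycleTrees M j₁ j₂, c T' * ∏ k ∈ univ \ T', heppZ t k| * δ
      ≤ (∑ T' ∈ cycleTrees M j₁ j₂, |c T' * ∏ k ∈ univ \ T', heppZ t k|) * δ :=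
        mul_le_mul_of_nonneg_right (Finset.abs_sum_le_sum_abs _ _) hδ0
    _ = ∑ T' ∈ cycleTrees M j₁ j₂, |c T'| * ((∏ k ∈ univ \ T', heppZ t k) * δ) := by
        rw [Finset.sum_mul]
        refine Finset.sum_congr rfl fun T' _ => ?_
        rw [abs_mul, abs_of_nonneg (Finset.prod_nonneg fun k _ => heppZ_nonneg t ht0 k)]
        ring
    _ ≤ ∑ T' ∈ cycleTrees M j₁ j₂, ∏ i : Fin L, t i ^ loopNum M (suffix L i) := by
        refine Finset.sum_le_sum fun T' hT' => ?_
        obtain ⟨C, hCT, hC, hbase, hj₁, hj₂⟩ := (mem_cycleTrees M).1 hT'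
        have hterm := prod_heppZ_treeWithCycle_mul_le M hCT hC hbase hj₁ hj₂ t ht0 ht1
        have hnn : 0 ≤ (∏ k ∈ univ \ T', heppZ t k) * δ :=
          mul_nonneg (Finset.prod_nonneg fun k _ => heppZ_nonneg t ht0 k) hδ0
        calc |c T'| * ((∏ k ∈ univ \ T', heppZ t k) * δ) ≤ 1 * ((∏ k ∈ univ \ T', heppZ t k) * δ) :=
              mul_le_mul_of_nonneg_right (hc T') hnn
          _ ≤ ∏ i : Fin L, t i ^ loopNum M (suffix L i) := by rw [one_mul]; exact hterm
    _ = (cycleTrees M j₁ j₂).card * ∏ i : Fin L, t i ^ loopNum M (suffix L i) := by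
        rw [Finset.sum_const, nsmul_eq_mul]

/-- Each factor of K: `|B_{j₁j₂}(z)/D(z)| ≤ (#trees with cycle through j₁,j₂) · ∏_k t_k^{−[j₁,j₂ ∈ s^{[k]}]}` in the open sector ("this
tuple gives a contribution not exceeding C·∏ t_l^{a_l}"). [cite: Volkov2020, proof of Lemma 3.3 (journal p.11; tex l.345–358)] -/
theorem abs_cycleSum_div_treeSum_le (M : Matroid (Fin L)) (c : Finset (Fin L) → ℝ) (hc : ∀ T', |c T'| ≤ 1) (j₁ j₂ : Fin L)
    (t : Fin L → ℝ) (ht : ∀ k, 0 < t k) (ht1 : ∀ k : Fin L, 0 < (k : ℕ) → t k ≤ 1) :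
    |cycleSum M c j₁ j₂ (heppZ t) / treeSum M (heppZ t)| ≤
      (cycleTrees M j₁ j₂).card * (∏ i : Fin L, t i ^ (if j₁ ∈ suffix L i ∧ j₂ ∈ suffix L i then 1 else 0))⁻¹ := by
  have ht0 : ∀ k, 0 ≤ t k := fun k => (ht k).le
  have hD := treeSum_pos M t ht
  have hδ : 0 < ∏ i : Fin L, t i ^ (if j₁ ∈ suffix L i ∧ j₂ ∈ suffix L i then 1 else 0) :=
    Finset.prod_pos fun i _ => pow_pos (ht i) _
  have hmain := abs_cycleSum_mul_le M c hc j₁ j₂ t ht0 ht1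
  have hlow := prod_pow_loopNum_le_treeSum M t ht0
  rw [abs_div, abs_of_pos hD, div_le_iff₀ hD]
  -- |B| ≤ N δ⁻¹ D  ⇐  |B| δ ≤ N ∏ t^Loop ≤ N D
  have h2 : |cycleSum M c j₁ j₂ (heppZ t)| * ∏ i : Fin L, t i ^ (if j₁ ∈ suffix L i ∧ j₂ ∈ suffix L i then 1 else 0) ≤
      (cycleTrees M j₁ j₂).card * treeSum M (heppZ t) :=
    hmain.trans (mul_le_mul_of_nonneg_left hlow (Nat.cast_nonneg _))
  rw [← le_div_iff₀ hδ] at h2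
  calc |cycleSum M c j₁ j₂ (heppZ t)| ≤ (cycleTrees M j₁ j₂).card * treeSum M (heppZ t) /
        ∏ i : Fin L, t i ^ (if j₁ ∈ suffix L i ∧ j₂ ∈ suffix L i then 1 else 0) := h2
    _ = (cycleTrees M j₁ j₂).card * (∏ i : Fin L, t i ^ (if j₁ ∈ suffix L i ∧ j₂ ∈ suffix L i then 1 else 0))⁻¹ *
        treeSum M (heppZ t) := by ring

/-- Bookkeeping: Σ_{p∈P} [p ⊆ s] = |P[s]|. [cite: Volkov2020, §3.1 (journal p.10; tex l.290–294)] -/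
theorem sum_indicator_eq_pairsIn (P : Finset (Fin L × Fin L)) (s : Finset (Fin L)) :
    ∑ p ∈ P, (if p.1 ∈ s ∧ p.2 ∈ s then 1 else 0) = pairsIn P s := by
  unfold pairsIn
  rw [Finset.card_filter]

/-- **Lemma 3.3 (assembled)**: in the open sector (0 < t, t_k ≤ 1 for k ≥ 1), for any pairing P and any signs |c| ≤ 1,
`|K(z)| ≤ C · ∏_k t_k^{−2·Loop(s^{[k]}) − |P[s^{[k]}]|}` with `C = ∏_{p∈P} #(trees with cycle through p)` — the printed
"|K(z)| ≤ C·∏ t_l^{|s^{[l]}|−2·Loop(s^{[l]})−|P[s^{[l]}]|}/(z₁…z_L)" after "the right part equals C·∏ t_l^{−2·Loop(s^{[l]})−|P[s^{[l]}]|}"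
(Lemma 3.1 with T = ∅: ∏_l t_l^{|s^{[l]}|} = z₁…z_L; see `lemma33_printed`). [cite: Volkov2020, Lemma 3.3 (journal p.11; tex l.327–358)] -/
theorem lemma33 (M : Matroid (Fin L)) (P : Finset (Fin L × Fin L)) (c : Fin L × Fin L → Finset (Fin L) → ℝ)
    (hc : ∀ p T', |c p T'| ≤ 1) (t : Fin L → ℝ) (ht : ∀ k, 0 < t k) (ht1 : ∀ k : Fin L, 0 < (k : ℕ) → t k ≤ 1) :
    |kFactor M P c (heppZ t)| ≤ (∏ p ∈ P, ((cycleTrees M p.1 p.2).card : ℝ)) *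
      ∏ i : Fin L, (t i ^ (2 * loopNum M (suffix L i) + pairsIn P (suffix L i)))⁻¹ := by
  have ht0 : ∀ k, 0 ≤ t k := fun k => (ht k).le
  have hD := treeSum_pos M t ht
  set m : ℝ := ∏ i : Fin L, t i ^ loopNum M (suffix L i) with hm
  have hm0 : 0 < m := Finset.prod_pos fun i _ => pow_pos (ht i) _
  have hmD : m ≤ treeSum M (heppZ t) := prod_pow_loopNum_le_treeSum M t ht0
  -- the indicator monomial of a pair
  set δ : Fin L × Fin L → ℝ := fun p => ∏ i : Fin L, t i ^ (if p.1 ∈ suffix L i ∧ p.2 ∈ suffix L i then 1 else 0) with hδ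
  have hδ0 : ∀ p, 0 < δ p := fun p => Finset.prod_pos fun i _ => pow_pos (ht i) _
  -- step 1: |K| ≤ m⁻¹² · ∏_p (N_p · δ_p⁻¹)
  have hK : |kFactor M P c (heppZ t)| ≤ m⁻¹ ^ 2 * ∏ p ∈ P, ((cycleTrees M p.1 p.2).card : ℝ) * (δ p)⁻¹ := by
    unfold kFactor
    rw [abs_mul, Finset.abs_prod, abs_of_nonneg (pow_nonneg (inv_nonneg.2 hD.le) 2)]
    refine mul_le_mul ?_ ?_ (Finset.prod_nonneg fun p _ => abs_nonneg _) (pow_nonneg (inv_nonneg.2 hm0.le) 2)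
    · exact pow_le_pow_left₀ (inv_nonneg.2 hD.le) ((inv_le_inv₀ hD hm0).2 hmD) 2
    · exact Finset.prod_le_prod (fun p _ => abs_nonneg _)
        fun p _ => abs_cycleSum_div_treeSum_le M (c p) (hc p) p.1 p.2 t ht ht1
  -- step 2: the right-hand sides agree
  have hRHS : m⁻¹ ^ 2 * ∏ p ∈ P, ((cycleTrees M p.1 p.2).card : ℝ) * (δ p)⁻¹ =
      (∏ p ∈ P, ((cycleTrees M p.1 p.2).card : ℝ)) *
        ∏ i : Fin L, (t i ^ (2 * loopNum M (suffix L i) + pairsIn P (suffix L i)))⁻¹ := by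
    have h1 : ∏ p ∈ P, ((cycleTrees M p.1 p.2).card : ℝ) * (δ p)⁻¹ =
        (∏ p ∈ P, ((cycleTrees M p.1 p.2).card : ℝ)) * (∏ p ∈ P, δ p)⁻¹ := by
      rw [Finset.prod_mul_distrib, Finset.prod_inv_distrib]
    have h2 : ∏ p ∈ P, δ p = ∏ i : Fin L, t i ^ pairsIn P (suffix L i) := by
      simp only [hδ]
      rw [Finset.prod_comm]
      refine Finset.prod_congr rfl fun i _ => ?_
      rw [Finset.prod_pow_eq_pow_sum, sum_indicator_eq_pairsIn]
    have h3 : m⁻¹ ^ 2 = (∏ i : Fin L, t i ^ (2 * loopNum M (suffix L i)))⁻¹ := by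
      rw [hm, inv_pow, ← Finset.prod_pow]
      congr 1
      refine Finset.prod_congr rfl fun i _ => ?_
      rw [← pow_mul, mul_comm]
    rw [h1, h2, h3]
    have h4 : ∏ i : Fin L, (t i ^ (2 * loopNum M (suffix L i) + pairsIn P (suffix L i)))⁻¹ =
        (∏ i : Fin L, t i ^ (2 * loopNum M (suffix L i)))⁻¹ * (∏ i : Fin L, t i ^ pairsIn P (suffix L i))⁻¹ := by
      rw [← mul_inv, ← Finset.prod_mul_distrib, ← Finset.prod_inv_distrib]
      refine Finset.prod_congr rfl fun i _ => ?_
      rw [pow_add]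
    rw [h4]
    ring
  exact hK.trans (le_of_eq hRHS)

/-- **Lemma 3.3 in the printed display**: `|K(z)| ≤ C·∏_l t_l^{|s^{[l]}| − 2·Loop(s^{[l]}) − |P[s^{[l]}]|}/(z₁…z_L)` (integer exponents), with
the same constant. [cite: Volkov2020, Lemma 3.3 (journal p.11; tex l.327–331)] -/
theorem lemma33_printed (M : Matroid (Fin L)) (P : Finset (Fin L × Fin L)) (c : Fin L × Fin L → Finset (Fin L) → ℝ)
    (hc : ∀ p T', |c p T'| ≤ 1) (t : Fin L → ℝ) (ht : ∀ k, 0 < t k) (ht1 : ∀ k : Fin L, 0 < (k : ℕ) → t k ≤ 1) :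
    |kFactor M P c (heppZ t)| ≤ (∏ p ∈ P, ((cycleTrees M p.1 p.2).card : ℝ)) *
      (∏ i : Fin L, t i ^ (((suffix L i).card : ℤ) - 2 * (loopNum M (suffix L i) : ℤ) - (pairsIn P (suffix L i) : ℤ))) /
        ∏ k : Fin L, heppZ t k := by
  have hZ : ∏ k : Fin L, heppZ t k = ∏ i : Fin L, t i ^ (suffix L i).card := by
    rw [prod_heppZ_eq]
    refine Finset.prod_congr rfl fun i _ => ?_
    rw [Finset.univ_inter]
  have hZpos : 0 < ∏ k : Fin L, heppZ t k := Finset.prod_pos fun k _ => heppZ_pos t ht k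
  have hsplit : ∏ i : Fin L, t i ^ (((suffix L i).card : ℤ) - 2 * (loopNum M (suffix L i) : ℤ) - (pairsIn P (suffix L i) : ℤ)) =
      (∏ i : Fin L, t i ^ (suffix L i).card) *
        ∏ i : Fin L, (t i ^ (2 * loopNum M (suffix L i) + pairsIn P (suffix L i)))⁻¹ := by
    rw [← Finset.prod_mul_distrib]
    refine Finset.prod_congr rfl fun i _ => ?_
    have hexp : (((suffix L i).card : ℤ) - 2 * (loopNum M (suffix L i) : ℤ) - (pairsIn P (suffix L i) : ℤ)) =
        ((suffix L i).card : ℤ) - ((2 * loopNum M (suffix L i) + pairsIn P (suffix L i) : ℕ) : ℤ) := by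
      push_cast; ring
    rw [hexp, zpow_sub₀ (ht i).ne', zpow_natCast, zpow_natCast, div_eq_mul_inv]
  rw [hsplit, ← hZ, mul_div_assoc, mul_div_cancel_left₀ _ hZpos.ne']
  exact lemma33 M P c hc t ht ht1

end Hepp

end

end Literature.MathematicalPhysics.QuantumFieldTheory.Volkov2020
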